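import Summits.CriticalPhenomena.PercolationContinuityZ3.Theorems.PercNearOneGluingNoHeavyLowerTailKnQuestion8CoefficientwiseNoCoreDecoration
import HarnessLib

/-!
# Point rows (VREM) under 1-sums: the cut-vertex identity — anchored point rows reduce to the block chain — prim-lf-2 gen 68

Support file (`--supports stmt-CriticalPhenomena-4575`, closed), prover `prim-lf-2` (gen 68).  No definitions, no named facts, no sorries; standard axioms.
Memo `prim-lf-2/CW-SUBROWS-gen68.md` §4; companion of `…CoefficientwiseRemOneSum.lean` (the same identity for the root-edge row REM).

Setting (prim-lf-2 gen 67, `…CoefficientwisePointRowSourceDeletion.lean`): finite multigraph `ends : ι → Sym2 V`, root `x`, SOURCE vertex `a`, targets `W`,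
`C_v(s) = openCluster (ends '' s) v`, and the linear row
  `VREM_F(x,a,W)[g] := Σ_{s ⊆ F : a ∈ C_x s, ∀ w ∈ W ¬(w ∈ C_x s ∧ w ∈ C_x(F∖s))} (g(C_x s) − g(C_x(F∖s)))`
(for `a ∈ W` half the NC* POINT ROW `NC*_F(x,W)[1_a, g]`; CONJECTURE: always `≥ 0` — the minimal open linear atom of the programme, prim-lf-2 gen 67 §4).
1-SUM at the cut vertex `v`: disjoint edge sets `E`, `D` whose edges meet only at `v`, root `x` on `D`-edges only if `x = v`, targets `W₁` off the `D`-edges except `v`,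
targets `W₂ ∌ x` on no `E`-edge; glued functions `g_t(X) = g(X ∪ [v ∈ X]·C_v(t))`; `Ev₂(t) :⟺ ∀ w ∈ W₂, ¬(w ∈ C_v t ∧ w ∈ C_v(D∖t))`.
* `Coefficientwise.vrem_oneSum_eq` — for a source `a` off the piece (`a` on `D`-edges only if `a = v`):
    `VREM_{E∪D}(x,a,W₁∪W₂)[g] = Σ_{t ⊆ D} ( if Ev₂(t) then VREM_E(x,a,W₁)[g_t] else VREM_E(x,a,W₁∪{v})[g_t] )`
  (clusters glue as `C_x(s∪t) = C_x s ∪ [v∈C_x s]·C_v t`; a `W₂`-target is a core of `(s,t)` iff `v` is a core of `s` and the target a core of `t` in the piece; the blue side is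
  re-indexed by `t ↦ D∖t`, under which `Ev₂` is invariant);
* `Coefficientwise.vrem_nonneg_oneSum` — hence VREM-positivity for all target sets and monotone functions on `E` (source `a`) implies the same on `E ∪ D` for an ARBITRARY
  piece `D` hung at any vertex (targets inside the piece allowed, no hypothesis on `D`) — contrast gen 63's `nca_glue` for the bilinear NC* family, which needs the NCA
  hypothesis on both sides.  Iterating over the block–cut tree, the point-row conjecture for `(x, a)` reduces to the chain of blocks between `x` and `a`; for the minimal
  open atom (source `a = p` adjacent to `x`, prim-lf-2 gen 67 §4) to the 2-connected block of the edge `xp`.  (When the source lies inside the piece the identity acquires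
  the extra indicator `[a ∈ C_v t]`, which is not swap-invariant; that case is not a plain `E`-row and is not treated here.)
[cite: KozmaNitzan2024, Questions 8–9 (§5.5 p. 36) (context: the Question-8 pocket covariance programme)]
-/

namespace Summit.CriticalPhenomena.PercolationContinuityZ3.Theorems

open Finset Literature.Probability.Percolation

namespace Coefficientwise

variable {ι V : Type*} [DecidableEq ι]

open Classical in
/-- **CUT-VERTEX IDENTITY for the point row, source off the piece.**  Let `E, D ⊆ ι` be disjoint edge sets of `ends : ι → Sym2 V` whose edges can only share the vertex `v`, the root `x` and the
source `a` on `D`-edges only if equal to `v`; let the targets `W₁` lie on `D`-edges only if equal to `v`, and the targets `W₂` (`∌ x`) lie on no `E`-edge.  Then for every `g`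
`VREM_{E∪D}(x,a,W₁∪W₂)[g] = Σ_{t ⊆ D} (if (∀ w ∈ W₂, ¬(w ∈ C_v t ∧ w ∈ C_v(D∖t))) then VREM_E(x,a,W₁)[g_t] else VREM_E(x,a,insert v W₁)[g_t])`,
`g_t(X) = g(X ∪ {y | v ∈ X ∧ y ∈ C_v(t)})`.  [cite: KozmaNitzan2024, Questions 8–9 (§5.5 p. 36) (context)] -/
theorem vrem_oneSum_eq (ends : ι → Sym2 V) {E D : Finset ι} (hED : Disjoint E D) {x v a : V} (ha : ∀ e' ∈ D, a ∈ ends e' → a = v)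
    (hsep : ∀ e₁ ∈ E, ∀ e' ∈ D, ∀ w : V, w ∈ ends e₁ → w ∈ ends e' → w = v)
    (hx : ∀ e' ∈ D, x ∈ ends e' → x = v) (W₁ W₂ : Set V) (hW₁ : ∀ e' ∈ D, ∀ w ∈ W₁, w ∈ ends e' → w = v)
    (hW₂ : ∀ e₁ ∈ E, ∀ w ∈ W₂, w ∉ ends e₁) (hxW₂ : x ∉ W₂) (g : Set V → ℝ) :
    ∑ r ∈ (E ∪ D).powerset.filter (fun r : Finset ι => a ∈ openCluster (ends '' (↑r : Set ι)) x ∧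
          ∀ w ∈ W₁ ∪ W₂, ¬ (w ∈ openCluster (ends '' (↑r : Set ι)) x ∧ w ∈ openCluster (ends '' (↑((E ∪ D) \ r) : Set ι)) x)),
      (g (openCluster (ends '' (↑r : Set ι)) x) - g (openCluster (ends '' (↑((E ∪ D) \ r) : Set ι)) x)) =
    ∑ t ∈ D.powerset,
      (if (∀ w ∈ W₂, ¬ (w ∈ openCluster (ends '' (↑t : Set ι)) v ∧ w ∈ openCluster (ends '' (↑(D \ t) : Set ι)) v)) then
        ∑ s ∈ E.powerset.filter (fun s : Finset ι => a ∈ openCluster (ends '' (↑s : Set ι)) x ∧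
            ∀ w ∈ W₁, ¬ (w ∈ openCluster (ends '' (↑s : Set ι)) x ∧ w ∈ openCluster (ends '' (↑(E \ s) : Set ι)) x)),
          (g (openCluster (ends '' (↑s : Set ι)) x ∪ {y | v ∈ openCluster (ends '' (↑s : Set ι)) x ∧ y ∈ openCluster (ends '' (↑t : Set ι)) v}) -
            g (openCluster (ends '' (↑(E \ s) : Set ι)) x ∪ {y | v ∈ openCluster (ends '' (↑(E \ s) : Set ι)) x ∧ y ∈ openCluster (ends '' (↑t : Set ι)) v}))
      else
        ∑ s ∈ E.powerset.filter (fun s : Finset ι => a ∈ openCluster (ends '' (↑s : Set ι)) x ∧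
            ∀ w ∈ insert v W₁, ¬ (w ∈ openCluster (ends '' (↑s : Set ι)) x ∧ w ∈ openCluster (ends '' (↑(E \ s) : Set ι)) x)),
          (g (openCluster (ends '' (↑s : Set ι)) x ∪ {y | v ∈ openCluster (ends '' (↑s : Set ι)) x ∧ y ∈ openCluster (ends '' (↑t : Set ι)) v}) -
            g (openCluster (ends '' (↑(E \ s) : Set ι)) x ∪ {y | v ∈ openCluster (ends '' (↑(E \ s) : Set ι)) x ∧ y ∈ openCluster (ends '' (↑t : Set ι)) v}))) := by
  -- notation
  set K : Finset ι → Set V := fun s => openCluster (ends '' (↑s : Set ι)) x with hK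
  set R : Finset ι → Set V := fun t => openCluster (ends '' (↑t : Set ι)) v with hR
  set gl : Set V → Set V → Set V := fun X Y => X ∪ {y | v ∈ X ∧ y ∈ Y} with hgl
  set Ev₂ : Finset ι → Prop := fun t => ∀ w ∈ W₂, ¬ (w ∈ R t ∧ w ∈ R (D \ t)) with hEv₂
  change ∑ r ∈ (E ∪ D).powerset.filter (fun r => a ∈ K r ∧ ∀ w ∈ W₁ ∪ W₂, ¬ (w ∈ K r ∧ w ∈ K ((E ∪ D) \ r))),
      (g (K r) - g (K ((E ∪ D) \ r))) =
    ∑ t ∈ D.powerset, (if Ev₂ t then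
        ∑ s ∈ E.powerset.filter (fun s => a ∈ K s ∧ ∀ w ∈ W₁, ¬ (w ∈ K s ∧ w ∈ K (E \ s))), (g (gl (K s) (R t)) - g (gl (K (E \ s)) (R t)))
      else
        ∑ s ∈ E.powerset.filter (fun s => a ∈ K s ∧ ∀ w ∈ insert v W₁, ¬ (w ∈ K s ∧ w ∈ K (E \ s))), (g (gl (K s) (R t)) - g (gl (K (E \ s)) (R t))))
  have mem_gl : ∀ (X Y : Set V) (y : V), y ∈ gl X Y ↔ y ∈ X ∨ (v ∈ X ∧ y ∈ Y) := fun X Y y => by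
    simp only [hgl, Set.mem_union, Set.mem_setOf_eq]
  -- `W₁`-targets meet the piece only at `v`
  have hwR : ∀ t : Finset ι, t ⊆ D → ∀ w ∈ W₁, w ∈ R t → w = v := by
    intro t ht w hw hwt
    by_contra hwv
    obtain ⟨e', he', hwe'⟩ := exists_edge_of_mem_openCluster ends hwt hwv
    exact hwv (hW₁ e' (ht he') w hw hwe')
  have w_gl : ∀ (X : Set V) (t : Finset ι), t ⊆ D → ∀ w ∈ W₁, (w ∈ gl X (R t) ↔ w ∈ X) := by
    intro X t ht w hw
    rw [mem_gl]
    constructor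
    · rintro (h1 | ⟨hu, h2⟩)
      · exact h1
      · rw [hwR t ht w hw h2]; exact hu
    · exact Or.inl
  -- `W₂`-targets are not on `E`-edges, hence never in an `E`-cluster of `x`
  have hwK : ∀ s : Finset ι, s ⊆ E → ∀ w ∈ W₂, w ∉ K s := by
    intro s hs w hw hws
    have hwx : w ≠ x := fun h => hxW₂ (h ▸ hw)
    obtain ⟨e₁, he₁, hwe₁⟩ := exists_edge_of_mem_openCluster ends hws hwx
    exact hW₂ e₁ (hs he₁) w hw hwe₁
  have w₂_gl : ∀ (s t : Finset ι), s ⊆ E → ∀ w ∈ W₂, (w ∈ gl (K s) (R t) ↔ (v ∈ K s ∧ w ∈ R t)) := by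
    intro s t hs w hw
    rw [mem_gl]
    constructor
    · rintro (h1 | h2)
      · exact absurd h1 (hwK s hs w hw)
      · exact h2
    · exact Or.inr
  -- cluster decomposition under gluing at `v`
  have decomp : ∀ s t : Finset ι, s ⊆ E → t ⊆ D → K (s ∪ t) = gl (K s) (R t) := by
    intro s t hs ht
    ext y
    rw [mem_gl]
    exact mem_openCluster_union_glue ends (fun e₁ he₁ e' he' w hw hw' => hsep e₁ (hs he₁) e' (ht he') w hw hw')
      (fun e' he' hxe => hx e' (ht he') hxe) y
  -- the source meets the piece only at `v`
  have ha_gl : ∀ (X : Set V) (t : Finset ι), t ⊆ D → (a ∈ gl X (R t) ↔ a ∈ X) := by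
    intro X t ht
    rw [mem_gl]
    constructor
    · rintro (h1 | ⟨hu, h2⟩)
      · exact h1
      · by_cases hav : a = v
        · rw [hav]; exact hu
        · obtain ⟨e', he', hae'⟩ := exists_edge_of_mem_openCluster ends h2 hav
          exact absurd (ha e' (ht he') hae') hav
    · exact Or.inl
  -- the glued no-core event
  have hevent : ∀ s t : Finset ι, s ⊆ E → t ⊆ D →
      ((a ∈ gl (K s) (R t) ∧ ∀ w ∈ W₁ ∪ W₂, ¬ (w ∈ gl (K s) (R t) ∧ w ∈ gl (K (E \ s)) (R (D \ t)))) ↔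
        (a ∈ K s ∧ (∀ w ∈ W₁, ¬ (w ∈ K s ∧ w ∈ K (E \ s))) ∧ ((v ∈ K s ∧ v ∈ K (E \ s)) → Ev₂ t))) := by
    intro s t hs ht
    rw [ha_gl _ _ ht]
    refine and_congr Iff.rfl ?_
    constructor
    · intro h
      refine ⟨fun w hw => ?_, fun hvZ w hw hwc => ?_⟩
      · have h' := h w (Set.mem_union_left _ hw)
        rwa [w_gl _ _ ht w hw, w_gl _ _ Finset.sdiff_subset w hw] at h'
      · have h' := h w (Set.mem_union_right _ hw)
        rw [w₂_gl s t hs w hw, w₂_gl (E \ s) (D \ t) Finset.sdiff_subset w hw] at h'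
        exact h' ⟨⟨hvZ.1, hwc.1⟩, ⟨hvZ.2, hwc.2⟩⟩
    · rintro ⟨h1, h2⟩ w hw
      rcases (Set.mem_union _ _ _).mp hw with hw | hw
      · rw [w_gl _ _ ht w hw, w_gl _ _ Finset.sdiff_subset w hw]
        exact h1 w hw
      · rw [w₂_gl s t hs w hw, w₂_gl (E \ s) (D \ t) Finset.sdiff_subset w hw]
        rintro ⟨⟨hvK, hwR⟩, ⟨hvB, hwR'⟩⟩
        exact h2 ⟨hvK, hvB⟩ w hw ⟨hwR, hwR'⟩
  simp only [Finset.sum_filter]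
  rw [DualBHK.sum_powerset_union hED, Finset.sum_comm]
  -- rewrite each summand through the gluing
  set cond : Finset ι → Finset ι → Prop := fun s t =>
    a ∈ K s ∧ (∀ w ∈ W₁, ¬ (w ∈ K s ∧ w ∈ K (E \ s))) ∧ ((v ∈ K s ∧ v ∈ K (E \ s)) → Ev₂ t) with hcondDef
  have hsummand : ∀ t ∈ D.powerset, ∀ s ∈ E.powerset,
      (if (a ∈ K (s ∪ t) ∧ ∀ w ∈ W₁ ∪ W₂, ¬ (w ∈ K (s ∪ t) ∧ w ∈ K ((E ∪ D) \ (s ∪ t))))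
        then (g (K (s ∪ t)) - g (K ((E ∪ D) \ (s ∪ t)))) else 0)
      = (if cond s t then g (gl (K s) (R t)) else 0) - (if cond s t then g (gl (K (E \ s)) (R (D \ t))) else 0) := by
    intro t ht s hs
    have hs' := Finset.mem_powerset.mp hs
    have ht' := Finset.mem_powerset.mp ht
    have hK1 : K (s ∪ t) = gl (K s) (R t) := decomp s t hs' ht'
    have hKc : K ((E ∪ D) \ (s ∪ t)) = gl (K (E \ s)) (R (D \ t)) := by
      rw [union_sdiff_union_of_subset hED hs' ht']
      exact decomp (E \ s) (D \ t) Finset.sdiff_subset Finset.sdiff_subset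
    rw [hK1, hKc]
    by_cases hc : cond s t
    · rw [if_pos ((hevent s t hs' ht').mpr hc), if_pos hc, if_pos hc]
    · rw [if_neg (fun h => hc ((hevent s t hs' ht').mp h)), if_neg hc, if_neg hc, sub_zero]
  rw [Finset.sum_congr rfl fun t ht => Finset.sum_congr rfl fun s hs => hsummand t ht s hs]
  simp only [Finset.sum_sub_distrib]
  -- re-index the blue part by `t ↦ D ∖ t`; the event `Ev₂` and hence `cond` are swap-invariant
  have hEv₂symm : ∀ t : Finset ι, t ⊆ D → (Ev₂ (D \ t) ↔ Ev₂ t) := by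
    intro t ht
    simp only [hEv₂, Finset.sdiff_sdiff_eq_self ht]
    exact forall₂_congr fun w _ => not_congr and_comm
  have hcondsymm : ∀ s t : Finset ι, t ⊆ D → (cond s (D \ t) ↔ cond s t) := by
    intro s t ht
    simp only [hcondDef, hEv₂symm t ht]
  have hflip : ∑ t ∈ D.powerset, ∑ s ∈ E.powerset, (if cond s t then g (gl (K (E \ s)) (R (D \ t))) else 0) =
      ∑ t ∈ D.powerset, ∑ s ∈ E.powerset, (if cond s t then g (gl (K (E \ s)) (R t)) else 0) := by
    rw [← sum_powerset_sdiff D (fun t => ∑ s ∈ E.powerset, (if cond s t then g (gl (K (E \ s)) (R (D \ t))) else 0))]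
    refine Finset.sum_congr rfl fun t ht => Finset.sum_congr rfl fun s _ => ?_
    have ht' := Finset.mem_powerset.mp ht
    rw [Finset.sdiff_sdiff_eq_self ht']
    by_cases hc : cond s t
    · rw [if_pos ((hcondsymm s t ht').mpr hc), if_pos hc]
    · rw [if_neg (fun h => hc ((hcondsymm s t ht').mp h)), if_neg hc]
  rw [hflip, ← Finset.sum_sub_distrib]
  refine Finset.sum_congr rfl fun t ht => ?_
  rw [← Finset.sum_sub_distrib]
  -- split according to `Ev₂ t`
  by_cases hE2 : Ev₂ t
  · rw [if_pos hE2]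
    refine Finset.sum_congr rfl fun s _ => ?_
    have hc : cond s t ↔ (a ∈ K s ∧ ∀ w ∈ W₁, ¬ (w ∈ K s ∧ w ∈ K (E \ s))) := by
      simp only [hcondDef]
      exact ⟨fun h => ⟨h.1, h.2.1⟩, fun h => ⟨h.1, h.2, fun _ => hE2⟩⟩
    by_cases h : cond s t
    · rw [if_pos h, if_pos h, if_pos (hc.mp h)]
    · rw [if_neg h, if_neg h, if_neg (fun h' => h (hc.mpr h')), sub_zero]
  · rw [if_neg hE2]
    refine Finset.sum_congr rfl fun s _ => ?_
    have hc : cond s t ↔ (a ∈ K s ∧ ∀ w ∈ insert v W₁, ¬ (w ∈ K s ∧ w ∈ K (E \ s))) := by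
      simp only [hcondDef, Set.forall_mem_insert]
      constructor
      · rintro ⟨h1, h2, h3⟩
        exact ⟨h1, fun hv => hE2 (h3 hv), h2⟩
      · rintro ⟨h1, h2, h3⟩
        exact ⟨h1, h3, fun hv => absurd hv h2⟩
    by_cases h : cond s t
    · rw [if_pos h, if_pos h, if_pos (hc.mp h)]
    · rw [if_neg h, if_neg h, if_neg (fun h' => h (hc.mpr h')), sub_zero]

open Classical in
/-- **Point-row positivity is closed under 1-sums with ARBITRARY pieces (source off the piece).**  Under the hypotheses of `vrem_oneSum_eq`: if `VREM_E(x,a,W')[φ] ≥ 0`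
for every target set `W'` and every monotone `φ`, then `VREM_{E∪D}(x,a,W₁∪W₂)[g] ≥ 0` for every monotone `g` — with no hypothesis on the glued piece `D`.
[cite: KozmaNitzan2024, Questions 8–9 (§5.5 p. 36) (context)] -/
theorem vrem_nonneg_oneSum (ends : ι → Sym2 V) {E D : Finset ι} (hED : Disjoint E D) {x v a : V} (ha : ∀ e' ∈ D, a ∈ ends e' → a = v)
    (hsep : ∀ e₁ ∈ E, ∀ e' ∈ D, ∀ w : V, w ∈ ends e₁ → w ∈ ends e' → w = v)
    (hx : ∀ e' ∈ D, x ∈ ends e' → x = v) (W₁ W₂ : Set V) (hW₁ : ∀ e' ∈ D, ∀ w ∈ W₁, w ∈ ends e' → w = v)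
    (hW₂ : ∀ e₁ ∈ E, ∀ w ∈ W₂, w ∉ ends e₁) (hxW₂ : x ∉ W₂)
    (h : ∀ (W' : Set V) (φ : Set V → ℝ), Monotone φ →
      0 ≤ ∑ s ∈ E.powerset.filter (fun s : Finset ι => a ∈ openCluster (ends '' (↑s : Set ι)) x ∧
            ∀ w ∈ W', ¬ (w ∈ openCluster (ends '' (↑s : Set ι)) x ∧ w ∈ openCluster (ends '' (↑(E \ s) : Set ι)) x)),
        (φ (openCluster (ends '' (↑s : Set ι)) x) - φ (openCluster (ends '' (↑(E \ s) : Set ι)) x)))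
    (g : Set V → ℝ) (hg : Monotone g) :
    0 ≤ ∑ r ∈ (E ∪ D).powerset.filter (fun r : Finset ι => a ∈ openCluster (ends '' (↑r : Set ι)) x ∧
          ∀ w ∈ W₁ ∪ W₂, ¬ (w ∈ openCluster (ends '' (↑r : Set ι)) x ∧ w ∈ openCluster (ends '' (↑((E ∪ D) \ r) : Set ι)) x)),
      (g (openCluster (ends '' (↑r : Set ι)) x) - g (openCluster (ends '' (↑((E ∪ D) \ r) : Set ι)) x)) := by
  rw [vrem_oneSum_eq ends hED ha hsep hx W₁ W₂ hW₁ hW₂ hxW₂ g]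
  refine Finset.sum_nonneg fun t _ => ?_
  have hmono : Monotone (fun X : Set V => g (X ∪ {y | v ∈ X ∧ y ∈ openCluster (ends '' (↑t : Set ι)) v})) := by
    intro X X' hXX'
    refine hg (Set.union_subset_union hXX' ?_)
    intro y hy
    exact ⟨hXX' hy.1, hy.2⟩
  split_ifs
  · exact h W₁ _ hmono
  · exact h (insert v W₁) _ hmono

end Coefficientwise

end Summit.CriticalPhenomena.PercolationContinuityZ3.Theorems
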